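import Summits.AtomisticToContinuum.BoseEinsteinCondensation.Theorems.FibreConductance.Negative.FreeFloor

/-!
# Crux `FibreConductance` — the free constant `1/4π²` is attained (canonical flow)

`integral_cellN_fderiv_eq_zero` (integration by parts on the `N`-particle torus, complex form) and
`integral_cellWave_mul_fderiv` (moving `∂_{0,l}` off the test function onto `e_n(x₀)`); the
canonical potential flow `canonicalFlow = -i (k_l/|k|²) L⁻³ e_n(x₀)` has weak `x₀`-divergence
`L⁻³ e_n(x₀)` = the fibre charge of the constant state (`isFibreFlow_canonicalFlow`) and cost
EXACTLY `L²/(4π²|n|₂²)` (`sum_norm_sq_canonicalFlow`), whence `fibreBoundAt_constState`: at `v = 0`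
the crux's conclusion HOLDS for the constant state (an exact zero-free minimiser) with `C = 1/4π²`
for every `n ≠ 0`.  Together with `FreeFloor.fibreConductanceWith_zero_const_ge` the free value is
pinned: `1/4π²` is attained and cannot be improved.  (Positive calibration of the typed weight
`W/ψ²`; a template for provers constructing flows and checking the weak-divergence clause.)

Crux disprover file for `stmt-AtomisticToContinuum-9480` (route `BECThomsonPrinciple`, crux
`FibreConductance`); part of the chain `Profiles → OneDimAxis → (FibreVocabulary) → SlabState →
TestFunction → NearMinimiserFalse` proving `not_fibreConductanceNearMinimiser`: the exact-minimiser
hypothesis (H1) of the crux cannot be relaxed to `δ`-near-minimality for any `δ > 0`.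
All [folklore] (elementary real analysis).
-/

noncomputable section

namespace Summit.AtomisticToContinuum.BoseEinsteinCondensation.Theorems.FibreConductance.Negative

open MeasureTheory Literature.MathematicalPhysics.QuantumManyBody.BoseGas
open scoped ENNReal NNReal

/-! ### The free constant is attained: the canonical flow at the constant state -/

section CanonicalFlow

open Real
open Summit.AtomisticToContinuum.BoseEinsteinCondensation.Theorems.GaussianDominationCan.Negative
variable {m : ℕ} {L : ℝ} {n : Fin 3 → ℤ}

/-- Chain rule for slices (complex-valued): the `e_k`-derivative of `y ↦ G(insertNth i y Y)` is the
`(i,k)` partial derivative of `G`. [folklore] -/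
theorem fderiv_slice_apply_complex {N : ℕ} {G : Config (N + 1) → ℂ} (hG : Differentiable ℝ G)
    (i : Fin (N + 1)) (k : Fin 3) (Y : Fin N → Space) (x : Space) :
    fderiv ℝ (fun y : Space => G (Fin.insertNth (α := fun _ => Space) i y Y)) x (EuclideanSpace.single k 1) =
      fderiv ℝ G (Fin.insertNth (α := fun _ => Space) i x Y) (Pi.single i (EuclideanSpace.single k 1)) := by
  have h := ((hG _).hasFDerivAt.comp x
    (hasFDerivAt_insertNth i Y x)).fderiv
  rw [show (fun y : Space => G (Fin.insertNth (α := fun _ => Space) i y Y)) =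
      G ∘ fun y : Space => (Fin.insertNth (α := fun _ => Space) i y Y : Config (N + 1)) from rfl, h,
    ContinuousLinearMap.comp_apply, pi_single_id_apply]

/-- **Integration by parts on the `N`-particle torus, complex form**: `∫_{[0,L)^{3N}} ∂_{i,k} G = 0`
for a `C¹` complex function that is `Lℤ³`-periodic in every particle (Fubini in particle `i`, then
the one-particle `integral_cell_fderiv_eq_zero`). [folklore] -/
theorem integral_cellN_fderiv_eq_zero {N : ℕ} (hL : 0 < L) {G : Config (N + 1) → ℂ} (hG : ContDiff ℝ 1 G)
    (hper : ∀ (X : Config (N + 1)) (j : Fin (N + 1)) (l : Fin 3),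
      G (X + Pi.single j (EuclideanSpace.single l L)) = G X)
    (i : Fin (N + 1)) (k : Fin 3) :
    ∫ X in cellN (N + 1) L, fderiv ℝ G X (Pi.single i (EuclideanSpace.single k 1)) = 0 := by
  have hGd : Differentiable ℝ G := hG.differentiable one_ne_zero
  set P : Config (N + 1) → ℂ := fun X => fderiv ℝ G X (Pi.single i (EuclideanSpace.single k 1)) with hP
  have hPc : Continuous P := (hG.continuous_fderiv one_ne_zero).clm_apply continuous_const
  set e := MeasurableEquiv.piFinSuccAbove (fun _ : Fin (N + 1) => Space) i with he
  have hmp : MeasurePreserving e.symm (volume.prod volume) volume :=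
    (volume_preserving_piFinSuccAbove (fun _ : Fin (N + 1) => Space) i).symm
  have hesymm : ∀ z : Space × (Fin N → Space),
      e.symm z = Fin.insertNth (α := fun _ => Space) i z.1 z.2 := by
    intro z
    rw [he, MeasurableEquiv.piFinSuccAbove_symm_apply]
    funext j
    exact Fin.insertNthEquiv_apply _ _ _ _
  have hpre : e.symm ⁻¹' cellN (N + 1) L = cell L ×ˢ cellN N L := by
    ext ⟨x, Y⟩
    simp only [Set.mem_preimage, hesymm, Set.mem_prod, cellN, Set.mem_setOf_eq]
    rw [Fin.forall_iff_succAbove i]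
    simp [Fin.insertNth_apply_same, Fin.insertNth_apply_succAbove]
  have h1 : ∫ X in cellN (N + 1) L, P X =
      ∫ z in cell L ×ˢ cellN N L, P (Fin.insertNth (α := fun _ => Space) i z.1 z.2) ∂(volume.prod volume) := by
    rw [← hpre, ← hmp.setIntegral_preimage_emb e.symm.measurableEmbedding]
    simp only [hesymm]
  show ∫ X in cellN (N + 1) L, P X = 0
  rw [h1, ← Measure.prod_restrict]
  have hint : Integrable
      (fun z : Space × (Fin N → Space) => P (Fin.insertNth (α := fun _ => Space) i z.1 z.2))
      ((volume.restrict (cell L)).prod (volume.restrict (cellN N L))) := by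
    rw [Measure.prod_restrict, ← hpre]
    have hio : IntegrableOn P (cellN (N + 1) L) volume := integrableOn_cellN hPc L
    have h2 := (hmp.integrableOn_comp_preimage e.symm.measurableEmbedding).2 hio
    simpa only [IntegrableOn, Function.comp_def, hesymm] using h2
  rw [integral_prod_symm _ hint]
  refine integral_eq_zero_of_ae (Filter.Eventually.of_forall fun Y => ?_)
  have hg : ContDiff ℝ 1 (fun y : Space => G (Fin.insertNth (α := fun _ => Space) i y Y)) :=
    hG.comp (contDiff_insertNth i Y)
  have hgper : ∀ (y : Space) (l : Fin 3),
      G (Fin.insertNth (α := fun _ => Space) i (y + EuclideanSpace.single l L) Y) =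
        G (Fin.insertNth (α := fun _ => Space) i y Y) := by
    intro y l
    rw [insertNth_add_eq, hper]
  have h0 := integral_cell_fderiv_eq_zero hL hg hgper k
  simp_rw [fderiv_slice_apply_complex hGd i k Y] at h0
  exact h0

/-- **Moving a derivative off the test function**: for `C¹` periodic `η`,
`∫ e_n(x₀) ∂_{0,l}η = -(2πi n_l/L) ∫ e_n(x₀) η`. [folklore] -/
theorem integral_cellWave_mul_fderiv (hL : 0 < L) {η : Config (m + 1) → ℂ} (hη : ContDiff ℝ 1 η)
    (hper : ∀ (X : Config (m + 1)) (j : Fin (m + 1)) (l : Fin 3),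
      η (X + Pi.single j (EuclideanSpace.single l L)) = η X) (l : Fin 3) :
    ∫ X in cellN (m + 1) L, cellWave L n (X 0) * fderiv ℝ η X (Pi.single 0 (EuclideanSpace.single l 1)) =
      -(2 * π * Complex.I * (n l) / L) * ∫ X in cellN (m + 1) L, cellWave L n (X 0) * η X := by
  -- the product `G = e_n(x₀) η`
  set w : Config (m + 1) → ℂ := fun X => cellWave L n (X 0) with hw
  have hwd : ContDiff ℝ 1 w :=
    ((contDiff_cellWave L n).of_le (mod_cast le_top)).comp (contDiff_apply ℝ Space 0)
  have hG : ContDiff ℝ 1 (fun X => w X * η X) := hwd.mul hη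
  have hGper : ∀ (X : Config (m + 1)) (j : Fin (m + 1)) (l : Fin 3),
      w (X + Pi.single j (EuclideanSpace.single l L)) * η (X + Pi.single j (EuclideanSpace.single l L)) =
        w X * η X := by
    intro X j l'
    rw [hper]
    congr 1
    simp only [hw, Pi.add_apply]
    by_cases hj : j = 0
    · subst hj; rw [Pi.single_eq_same, cellWave_periodic hL.ne']
    · rw [Pi.single_eq_of_ne (Ne.symm hj), add_zero]
  have hIBP := integral_cellN_fderiv_eq_zero hL hG hGper 0 l
  -- product rule
  have hwderiv : ∀ X : Config (m + 1), fderiv ℝ w X (Pi.single 0 (EuclideanSpace.single l 1)) =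
      (2 * π * Complex.I * (n l) / L) * cellWave L n (X 0) := by
    intro X
    have hc := ((contDiff_cellWave L n).differentiable (by simp) (X 0)).hasFDerivAt.comp X
      (hasFDerivAt_apply (𝕜 := ℝ) 0 X)
    rw [show w = cellWave L n ∘ (fun f : Config (m + 1) => f 0) from rfl, hc.fderiv,
      ContinuousLinearMap.comp_apply]
    show fderiv ℝ (cellWave L n) (X 0) ((Pi.single 0 (EuclideanSpace.single l (1 : ℝ)) : Config (m + 1)) 0) = _
    rw [Pi.single_eq_same, fderiv_cellWave_apply_single]
  have hprod : ∀ X : Config (m + 1), fderiv ℝ (fun X => w X * η X) X (Pi.single 0 (EuclideanSpace.single l 1)) =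
      (2 * π * Complex.I * (n l) / L) * cellWave L n (X 0) * η X +
        cellWave L n (X 0) * fderiv ℝ η X (Pi.single 0 (EuclideanSpace.single l 1)) := by
    intro X
    have h := (((hwd.differentiable one_ne_zero) X).hasFDerivAt.mul
      ((hη.differentiable one_ne_zero) X).hasFDerivAt).fderiv
    show (fderiv ℝ (w * η) X) (Pi.single 0 (EuclideanSpace.single l 1)) = _
    rw [h, _root_.add_apply, smul_apply, smul_apply, hwderiv, smul_eq_mul, smul_eq_mul]
    simp only [hw]
    ring
  simp_rw [hprod] at hIBP
  have hi1 : Integrable (fun X => (2 * π * Complex.I * (n l) / L) * cellWave L n (X 0) * η X)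
      (volume.restrict (cellN (m + 1) L)) := by
    refine integrableOn_cellN ?_ L
    exact (continuous_const.mul (hwd.continuous)).mul hη.continuous
  have hi2 : Integrable (fun X => cellWave L n (X 0) * fderiv ℝ η X (Pi.single 0 (EuclideanSpace.single l 1)))
      (volume.restrict (cellN (m + 1) L)) := by
    refine integrableOn_cellN ?_ L
    exact hwd.continuous.mul ((hη.continuous_fderiv one_ne_zero).clm_apply continuous_const)
  rw [integral_add hi1 hi2] at hIBP
  simp_rw [mul_assoc] at hIBP
  rw [integral_const_mul] at hIBP
  linear_combination hIBP

/-- The wave-number components `k_l = 2πn_l/L`. [folklore] -/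
def kcomp (L : ℝ) (n : Fin 3 → ℤ) (l : Fin 3) : ℝ := 2 * π * (n l) / L

/-- `|k|² = 4π²|n|²/L²`. [folklore] -/
def ksq (L : ℝ) (n : Fin 3 → ℤ) : ℝ := 4 * π ^ 2 * nsq n / L ^ 2

/-- `Σ_l k_l² = |k|²`. [folklore] -/
theorem sum_kcomp_sq (L : ℝ) (n : Fin 3 → ℤ) : ∑ l, kcomp L n l ^ 2 = ksq L n := by
  unfold kcomp ksq nsq
  rw [Finset.mul_sum, Finset.sum_div]
  refine Finset.sum_congr rfl fun l _ => ?_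
  ring

/-- `|n|² ≥ 1 > 0` for `n ≠ 0`. [folklore] -/
theorem nsq_pos (hn : n ≠ 0) : 0 < nsq n := by
  obtain ⟨j, hj⟩ := Function.ne_iff.1 hn
  have h1 : (1 : ℝ) ≤ (n j : ℝ) ^ 2 := by
    have : (1 : ℤ) ≤ n j ^ 2 := by nlinarith [Int.one_le_abs hj, sq_abs (n j)]
    exact_mod_cast this
  exact lt_of_lt_of_le one_pos (h1.trans (Finset.single_le_sum (f := fun j => (n j : ℝ) ^ 2)
    (fun i _ => sq_nonneg _) (Finset.mem_univ j)))

/-- `|k|² > 0` for `n ≠ 0`. [folklore] -/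
theorem ksq_pos (hL : 0 < L) (hn : n ≠ 0) : 0 < ksq L n := by
  unfold ksq; have := nsq_pos hn; positivity

/-- `‖n‖∞² ≤ |n|₂²`. [folklore] -/
theorem norm_sq_le_nsq (n : Fin 3 → ℤ) : ‖(fun j => (n j : ℝ))‖ ^ 2 ≤ nsq n := by
  have h : ‖(fun j => (n j : ℝ))‖ ≤ Real.sqrt (nsq n) := by
    refine (pi_norm_le_iff_of_nonneg (Real.sqrt_nonneg _)).2 fun j => ?_
    rw [Real.norm_eq_abs, ← Real.sqrt_sq_eq_abs]
    exact Real.sqrt_le_sqrt (Finset.single_le_sum (f := fun j => (n j : ℝ) ^ 2)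
      (fun i _ => sq_nonneg _) (Finset.mem_univ j))
  calc ‖(fun j => (n j : ℝ))‖ ^ 2 ≤ Real.sqrt (nsq n) ^ 2 := pow_le_pow_left₀ (norm_nonneg _) h 2
    _ = nsq n := Real.sq_sqrt (nsq_nonneg n)

/-- **The canonical (free) flow** `J_l(X) = -i (k_l/|k|²) L⁻³ e_n(x₀)` — potential flow of the free
charge `L⁻³e_n(x₀)` along `k̂`. [folklore] -/
def canonicalFlow (m : ℕ) (L : ℝ) (n : Fin 3 → ℤ) : Config (m + 1) → Fin 3 → ℂ := fun X l =>
  ((-(kcomp L n l / ksq L n / L ^ 3) : ℝ) : ℂ) * Complex.I * cellWave L n (X 0)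

/-- **The canonical flow has weak `x₀`-divergence `L⁻³e_n(x₀)`.** [folklore] -/
theorem isFibreFlow_canonicalFlow (hL : 0 < L) (hn : n ≠ 0) :
    IsFibreFlow m L (fun X => (((L ^ 3)⁻¹ : ℝ) : ℂ) * cellWave L n (X 0)) (canonicalFlow m L n) := by
  intro η hη hper
  have hk := ksq_pos hL hn
  have hstep : ∀ l : Fin 3, ∫ X in cellN (m + 1) L,
      canonicalFlow m L n X l * fderiv ℝ η X (Pi.single 0 (EuclideanSpace.single l 1)) =
        (((kcomp L n l / ksq L n / L ^ 3) : ℝ) : ℂ) * Complex.I * (2 * π * Complex.I * (n l) / L) *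
          ∫ X in cellN (m + 1) L, cellWave L n (X 0) * η X := by
    intro l
    unfold canonicalFlow
    simp_rw [mul_assoc]
    rw [integral_const_mul, integral_const_mul, integral_cellWave_mul_fderiv hL hη hper l]
    push_cast
    ring
  -- `Σ_l (k_l/|k|²L³) i (2πi n_l/L) = -L⁻³`
  have hsum : ∑ l : Fin 3, (((kcomp L n l / ksq L n / L ^ 3) : ℝ) : ℂ) * Complex.I *
      (2 * π * Complex.I * (n l) / L) = -((((L ^ 3)⁻¹ : ℝ)) : ℂ) := by
    have e : ∀ l : Fin 3, (((kcomp L n l / ksq L n / L ^ 3) : ℝ) : ℂ) * Complex.I *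
        (2 * π * Complex.I * (n l) / L) = -((((kcomp L n l ^ 2 / ksq L n / L ^ 3) : ℝ)) : ℂ) := by
      intro l
      have hI : Complex.I * Complex.I = -1 := Complex.I_mul_I
      unfold kcomp
      push_cast
      linear_combination ((2 * π * (n l : ℂ) / L) / (ksq L n : ℂ) / (L : ℂ) ^ 3 * (2 * π * (n l : ℂ) / L)) * hI
    simp_rw [e]
    rw [Finset.sum_neg_distrib, ← Complex.ofReal_sum, ← Finset.sum_div, ← Finset.sum_div, sum_kcomp_sq,
      div_self hk.ne', one_div]
  rw [integral_finsetSum _ (fun l _ => ?_)]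
  · simp_rw [hstep]
    rw [← Finset.sum_mul, hsum]
    simp_rw [mul_assoc]
    rw [MeasureTheory.integral_const_mul]
    ring
  · unfold canonicalFlow
    refine integrableOn_cellN ?_ L
    refine Continuous.mul ?_ ((hη.continuous_fderiv one_ne_zero).clm_apply continuous_const)
    exact continuous_const.mul ((continuous_cellWave L n).comp (continuous_apply 0))

/-- `Σ_l |J_l|² = L⁻⁶/|k|²` (constant). [folklore] -/
theorem sum_norm_sq_canonicalFlow (hL : 0 < L) (hn : n ≠ 0) (X : Config (m + 1)) :
    ∑ l : Fin 3, ‖canonicalFlow m L n X l‖ ^ 2 = (L ^ 3)⁻¹ ^ 2 / ksq L n := by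
  have hk := ksq_pos hL hn
  have hl : ∀ l : Fin 3, ‖canonicalFlow m L n X l‖ ^ 2 = kcomp L n l ^ 2 * ((ksq L n)⁻¹ / L ^ 3) ^ 2 := by
    intro l
    unfold canonicalFlow
    rw [norm_mul, norm_mul, Complex.norm_I, norm_cellWave, mul_one, mul_one, Complex.norm_real,
      Real.norm_eq_abs, sq_abs]
    ring
  simp_rw [hl]
  rw [← Finset.sum_mul, sum_kcomp_sq]
  field_simp

/-- **The free fibre bound at the constant state**: for `v = 0`, the constant state (an exact
zero-free minimiser) and any `n ≠ 0`, the canonical flow realises the crux's conclusion with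
`C = 1/4π²`: its weak divergence is the fibre charge and its cost is EXACTLY `L²/(4π²|n|₂²) ≤
(1/4π²) L²/‖n‖∞²`.  With `fibreConductanceWith_zero_const_ge` (the floor `C ≥ 1/4π²`), the
free value is pinned. [folklore] -/
theorem fibreBoundAt_constState (hL : 0 < L) (hn : n ≠ 0) {c : ℝ} (hcdef : c = (Real.sqrt (L ^ 3))⁻¹)
    (hc : c ^ 2 * L ^ 3 = 1) :
    FibreBoundAt L n (constState m hL c hc) (1 / (4 * π ^ 2)) := by
  have hL3 : 0 < L ^ 3 := by positivity
  have hcpos : 0 < c := by rw [hcdef]; exact inv_pos.2 (Real.sqrt_pos.2 hL3)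
  have hc2 : c ^ 2 = (L ^ 3)⁻¹ := by rw [hcdef, inv_pow, Real.sq_sqrt hL3.le]
  have hk := ksq_pos hL hn
  have hφpos : ∀ y : Space, 0 < (fun _ : Space => c) y := fun _ => hcpos
  have hnorm1 : ∫ y in cell L, (fun _ : Space => c) y ^ 2 = 1 := by
    show ∫ _y in cell L, c ^ 2 = 1
    rw [integral_cell_const_sq hL.le, hc]
  -- the fibre charge of the constant state is `L⁻³ e_n(x₀)`
  have hβ : ∫ y in cell L, wave L n y * (((fun _ : Space => c) y : ℝ) : ℂ) = 0 := by
    show ∫ y in cell L, wave L n y * (c : ℂ) = 0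
    simp_rw [wave_eq_cellWave]
    rw [integral_mul_const, integral_cell_cellWave_eq_zero hL hn, zero_mul]
  have hcc : ((Real.sqrt (L ^ 3))⁻¹ : ℂ) * (c : ℂ) = (((L ^ 3)⁻¹ : ℝ) : ℂ) := by
    rw [hcdef, ← Complex.ofReal_inv, ← Complex.ofReal_mul, ← sq, inv_pow, Real.sq_sqrt hL3.le]
  have hq : fibreCharge L n (constState m hL c hc).ψ = fun X => (((L ^ 3)⁻¹ : ℝ) : ℂ) * cellWave L n (X 0) := by
    funext X
    rw [constState_ψ_eq_realProd hL hc, fibreCharge_realProd hφpos hnorm1, hβ, zero_mul, sub_zero,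
      wave_eq_cellWave]
    linear_combination (cellWave L n (X 0)) * hcc
  refine ⟨canonicalFlow m L n, hq ▸ isFibreFlow_canonicalFlow hL hn, ?_⟩
  -- the cost
  rw [constState_ψ_eq_realProd hL hc, fibreCost_realProd hφpos hnorm1]
  simp_rw [sum_norm_sq_canonicalFlow hL hn, bathProd_const]
  rw [setLIntegral_cellN_const' hL.le, ← ENNReal.ofReal_mul (by positivity)]
  apply ENNReal.ofReal_le_ofReal
  -- `(L⁻³)²/|k|² · ((c²)^m/c²) · (L³)^(m+1) = 1/|k|² ≤ (1/4π²) L²/‖n‖∞²`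
  have hc2m : (c ^ 2) ^ m * (L ^ 3) ^ (m + 1) = L ^ 3 := by
    rw [hc2, inv_pow, pow_succ (L ^ 3) m, ← mul_assoc, inv_mul_cancel₀ (by positivity), one_mul]
  have hval : (L ^ 3)⁻¹ ^ 2 / ksq L n * ((c ^ 2) ^ m / c ^ 2) * (L ^ 3) ^ (m + 1) = 1 / ksq L n := by
    calc (L ^ 3)⁻¹ ^ 2 / ksq L n * ((c ^ 2) ^ m / c ^ 2) * (L ^ 3) ^ (m + 1)
        = (L ^ 3)⁻¹ ^ 2 / ksq L n / c ^ 2 * ((c ^ 2) ^ m * (L ^ 3) ^ (m + 1)) := by ring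
      _ = (L ^ 3)⁻¹ ^ 2 / ksq L n / (L ^ 3)⁻¹ * L ^ 3 := by rw [hc2m, hc2]
      _ = 1 / ksq L n := by field_simp
  rw [hval]
  have hnn : 0 < ‖(fun j => (n j : ℝ))‖ := lt_of_lt_of_le one_pos (one_le_norm_intVec hn)
  unfold ksq
  rw [div_le_div_iff₀ (by have := nsq_pos hn; positivity) (by positivity), one_mul,
    show 1 / (4 * π ^ 2) * L ^ 2 * (4 * π ^ 2 * nsq n / L ^ 2) = nsq n by field_simp]
  exact norm_sq_le_nsq n

end CanonicalFlow

end Summit.AtomisticToContinuum.BoseEinsteinCondensation.Theorems.FibreConductance.Negative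

end
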